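import Summits.BirchSwinnertonDyer.BirchSwinnertonDyer.Theses.TwoAdicConverse
import Summits.BirchSwinnertonDyer.BirchSwinnertonDyer.Theorems.TwoAdicConverseLambdaHalfDefs
import Literature.NumberTheory.EllipticCurves.KatoKolyvaginPrimes
import Literature.NumberTheory.EllipticCurves.KuriharaNumber
import Literature.NumberTheory.EllipticCurves.PAdicLFunctionIntegralityAtTwoProofs
import Literature.NumberTheory.EllipticCurves.PAdicLFunctionDistributionProofs
import Literature.NumberTheory.EllipticCurves.GaloisAction
import Literature.NumberTheory.EllipticCurves.BSDInvariants
import Mathlib.NumberTheory.LegendreSymbol.JacobiSymbol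
import HarnessLib

/-! # Sketch — crux idea `omega-adic-kolyvagin-two` (crux-ideate GEN 7, ideator 2, item stmt-BirchSwinnertonDyer-19556)

Crux `OrdLambdaHalfAtTwo` (route `TwoAdicConverse`, S3). BSD is NOT proved by anything here; the crux stays open.

THE LEVER. `λ` at `2` is a MOD-2 invariant: with `Ω := Λ/2Λ = 𝔽₂⟦T⟧` (a DVR, uniformiser `T`), `λ_alg = length_Ω(X/2X)` and
`λ_an = ord_T(c·L₂ mod 2)` when `μ = 0`. So run Mazur–Rubin Kolyvagin rigidity with COEFFICIENTS `Ω_j = 𝔽₂[T]/(T^j)` on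
`E[2] ⊗ Ω_j(Ψ̄)` (Kato's Λ-adic system reduced mod 2), with Kolyvagin primes = TRANSPOSITION primes `q ≡ ±1 (mod 2^{ε+2})`
(depth bought in the REAL cyclotomic tower, `2^{ε+1} ≥ j`): the three integral obstructions of the sibling line at `2` (the class
`c₀ ∈ H¹(ℚ(E[4])/ℚ, E[4])`, the Tamagawa/Euler level shift, `μ` as an input) are absent over `Ω`, and exact rigidity over the DVR `Ω`
gives `λ_alg = λ_an` (no one-directional slack). Supply = ONE odd level-one Kurihara number on deep transposition primes; at
`p = 2` a level-one `ψ_ℓ` IS the Legendre symbol, so `δ_n` is the parity of the non-residue CELL `Z_n` of the Manin–Zhai partition,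
`2^{ν(n)} Z_n = c Σ_{d ∣ n, d ≡ 1 (4)} ± ∏_{q ∣ n/d}(a_q − 2χ_d(q)) · U_d`, `U_d ∝ L(E^{(d)}, 1)` (Birch; Zhai, Cai–Li–Zhai).

§1 (PROVED, no sorry): the PAIRING LAW — `a ↦ −a` pairs the terms of `δ_n` whenever every prime of `n` is `≡ 1 (mod 4)`; hence NO
scaled Kurihara number at `2` is a unit at any level `k ≥ 2`, a unit witness has `n = 1` or (`k = 1` and a prime `≡ 3 (mod 4)` in `n`),
and (§3) a deep unit witness carries a prime `≡ −1 (mod 2^{ε+2})`.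
§2 (typed, nothing asserted): the cell `Z_n`, the twisted unit sums `U_{d,n}`, the dictionary Props.
§3 (typed + kernel-checked composition): `RealTowerDepth`, `DeepLevelOneUnitWitnessAtTwo`, the habitat `OmegaHabitat`, the transfer
`OmegaAdicRigidityAtTwo` (C⁺), the supply `DeepLevelOneSupplyAtTwo` / `DeepZhaiCellSupplyAtTwo`, the off-habitat residual, and
`ordLambdaHalfAtTwo_of_omegaAdic : (Ω-R) → (Ω-S) → (off-𝓗) → OrdLambdaHalfAtTwo` BY NAME.
§0 keeps ideator 1's interface verbatim (for comparison only; this line does not go through `TwoPowerSlackRigidityAtTwo`). -/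

set_option linter.dupNamespace false
set_option autoImplicit false

noncomputable section

open scoped Classical MatrixGroups ModularForm
open CongruenceSubgroup WeierstrassCurve Literature.NumberTheory.EllipticCurves
  Literature.NumberTheory.EllipticCurves.ModularForms Literature.NumberTheory.EllipticCurves.Rank1Residual
  Summit.BirchSwinnertonDyer.BirchSwinnertonDyer.Theorems.TwoAdicTwistConverse
open Literature.NumberTheory.DiophantineGeometry.Dioph (ratModP)

namespace Summit.BirchSwinnertonDyer.BirchSwinnertonDyer.Cruxes.OrdLambdaHalfAtTwo.OmegaAdicKolyvaginTwo

/-! ## §0. Interface of line `two-power-slack-rigidity-two` (ideator 1, GEN 7) — VERBATIM COPY of the five declarations of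
`Cruxes/OrdLambdaHalfAtTwo/TwoPowerSlackRigidityTwoSketch.lean` this sketch plugs into (that workfile is not a built module,
so it cannot be imported on the farm; signatures identical — a registered line imports the original instead). -/
namespace FromIdeatorOne

/-- [ideator 1] the `c`-scaled Kurihara number at `2`: `δ^{(c)}_n = ∑_{a ∈ (ℤ/n)ˣ} \overline{c·[a/n]⁺_f} · ∏_{ℓ ∣ n} ψ_ℓ(a) ∈ ℤ/2^k`. -/
def kuriharaNumberScaled {N : ℕ} (f : CuspForm (Gamma0 N) 2) (c : ℚ) (k n : ℕ) [NeZero n]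
    (ψ : (ℓ : ℕ) → (ZMod ℓ)ˣ →* Multiplicative (ZMod (2 ^ k))) : ZMod (2 ^ k) :=
  ∑ a : (ZMod n)ˣ, ratModP (2 ^ k) (c * ratPlusSymbol f (((a : ZMod n).val : ℚ) / n)) *
    ∏ ℓ ∈ n.primeFactors.attach,
      Multiplicative.toAdd (ψ ℓ.1 (ZMod.unitsMap (Nat.dvd_of_mem_primeFactors ℓ.2) a))

/-- [ideator 1] a UNIT Kurihara witness at `2` for `(W, f)`. -/
def UnitKuriharaWitnessAtTwo (W : WeierstrassCurve ℚ) [W.IsElliptic] [W.IsGloballyMinimal]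
    {N : ℕ} (f : CuspForm (Gamma0 N) 2) : Prop :=
  ∃ (c : ℚ) (k n : ℕ) (_ : NeZero n) (ψ : (ℓ : ℕ) → (ZMod ℓ)ˣ →* Multiplicative (ZMod (2 ^ k))),
    c ≠ 0 ∧ (∀ r : ℚ, ‖((c * ratPlusSymbol f r : ℚ) : ℚ_[2])‖ ≤ 1) ∧ 1 ≤ k ∧
    Kato.IsKolyvaginProduct W 2 k n ∧ (∀ ℓ ∈ n.primeFactors, Function.Surjective (ψ ℓ)) ∧
    IsUnit (kuriharaNumberScaled f c k n ψ)

/-- [ideator 1] TRANSFER `C⁺` (per curve, error-blind rigidity). -/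
def TwoPowerSlackRigidityAtTwo : Prop :=
  ∀ (W : WeierstrassCurve ℚ) [W.IsElliptic] [W.IsGloballyMinimal], ¬ W.HasCM → GoodOrd W 2 →
    (∀ [NeZero (W.conductorNorm ℤ)] (f : CuspForm (Gamma0 (W.conductorNorm ℤ)) 2), IsNewformOf W f →
      UnitKuriharaWitnessAtTwo W f) →
    LambdaHalfAtTwo W

/-- [ideator 1] SUPPLY (finite certificate per curve). -/
def UnitKuriharaSupplyAtTwo : Prop :=
  ∀ (W : WeierstrassCurve ℚ) [W.IsElliptic] [W.IsGloballyMinimal], ¬ W.HasCM → GoodOrd W 2 →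
    ∀ [NeZero (W.conductorNorm ℤ)] (f : CuspForm (Gamma0 (W.conductorNorm ℤ)) 2), IsNewformOf W f →
      UnitKuriharaWitnessAtTwo W f

/-- [ideator 1] composition: supply ∧ error-blind rigidity ⟹ the crux BY NAME. -/
theorem ordLambdaHalfAtTwo_of (hS : UnitKuriharaSupplyAtTwo) (hR : TwoPowerSlackRigidityAtTwo) :
    Summit.BirchSwinnertonDyer.BirchSwinnertonDyer.Theses.TwoAdicConverse.OrdLambdaHalfAtTwo := by
  show Summit.BirchSwinnertonDyer.BirchSwinnertonDyer.Theorems.TwoAdicTwistConverse.OrdLambdaHalfAtTwo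
  intro W _ _ hcm hgo
  exact hR W hcm hgo (fun f hf => hS W hcm hgo f hf)

end FromIdeatorOne

open FromIdeatorOne

/-! ## §1. The pairing law (proved) -/

/-- Reduction `ℤ/2^k → ℤ/2`, a ring homomorphism for `k ≥ 1`. -/
def toMod2 (k : ℕ) (hk : 1 ≤ k) : ZMod (2 ^ k) →+* ZMod 2 :=
  ZMod.castHom (dvd_pow_self 2 (by omega : k ≠ 0)) (ZMod 2)

theorem add_self_zmod_two (x : ZMod 2) : x + x = 0 := by
  have h2 : (2 : ZMod 2) = 0 := by decide
  rw [← two_mul, h2, zero_mul]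

/-- In `(ℤ/n)ˣ`, `n > 1` odd, the involution `a ↦ −a` has no fixed point. -/
theorem units_neg_ne_self {n : ℕ} [NeZero n] (hn : 1 < n) (hodd : Odd n) (a : (ZMod n)ˣ) : -a ≠ a := by
  intro h
  have hv : -((a : (ZMod n)ˣ) : ZMod n) = (a : ZMod n) := by
    rw [← Units.val_neg, h]
  have h2a : (2 : ZMod n) * (a : ZMod n) = 0 := by linear_combination -hv
  have h2 : (2 : ZMod n) = 0 := by
    have := congrArg (· * ((a⁻¹ : (ZMod n)ˣ) : ZMod n)) h2a
    simpa [mul_assoc] using this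
  have hdvd : n ∣ 2 := by
    have : ((2 : ℕ) : ZMod n) = 0 := by exact_mod_cast h2
    exact (ZMod.natCast_eq_zero_iff 2 n).1 this
  have hle : n ≤ 2 := Nat.le_of_dvd (by norm_num) hdvd
  obtain ⟨m, hm⟩ := hodd
  omega

/-- `[(−a)/n]⁺ = [a/n]⁺` on representatives: translation invariance + evenness of the plus symbol. -/
theorem ratPlusSymbol_val_neg_div {N : ℕ} [NeZero N] (f : CuspForm (Gamma0 N) 2) {n : ℕ} [NeZero n] (hn : 1 < n)
    (a : (ZMod n)ˣ) :
    ratPlusSymbol f (((((-a : (ZMod n)ˣ) : ZMod n).val : ℕ) : ℚ) / n) =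
      ratPlusSymbol f ((((a : ZMod n).val : ℕ) : ℚ) / n) := by
  haveI : Fact (1 < n) := ⟨hn⟩
  have hn0 : (n : ℚ) ≠ 0 := by exact_mod_cast (NeZero.ne n)
  have ha : (a : ZMod n) ≠ 0 := a.ne_zero
  have hval : ((-a : (ZMod n)ˣ) : ZMod n).val = n - (a : ZMod n).val := by
    rw [Units.val_neg, ZMod.neg_val, if_neg ha]
  have hlt : (a : ZMod n).val ≤ n := (ZMod.val_lt _).le
  have hcast : ((((-a : (ZMod n)ˣ) : ZMod n).val : ℕ) : ℚ) = (n : ℚ) - (((a : ZMod n).val : ℕ) : ℚ) := by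
    rw [hval, Nat.cast_sub hlt]
  have e : ((((-a : (ZMod n)ˣ) : ZMod n).val : ℕ) : ℚ) / n =
      -(((((a : ZMod n).val : ℕ) : ℚ)) / n) + ((1 : ℤ) : ℚ) := by
    rw [hcast]; push_cast; field_simp; ring
  rw [e, ratPlusSymbol_add_intCast_eq, ratPlusSymbol_neg]

/-- If `−1` is a square mod `ℓ` then `ψ_ℓ(−1)` is a square in `Multiplicative (ℤ/2^k)`, so its additive shadow is EVEN. -/
theorem toMod2_toAdd_neg_one_eq_zero {k : ℕ} (hk : 1 ≤ k) {ℓ : ℕ} (hℓ : ℓ.Prime) (h4 : ℓ % 4 = 1)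
    (ψ : (ZMod ℓ)ˣ →* Multiplicative (ZMod (2 ^ k))) :
    toMod2 k hk (Multiplicative.toAdd (ψ (-1))) = 0 := by
  haveI : Fact ℓ.Prime := ⟨hℓ⟩
  obtain ⟨y, hy⟩ := (ZMod.exists_sq_eq_neg_one_iff (p := ℓ)).2 (by omega)
  have hy0 : y ≠ 0 := by
    rintro rfl
    simp at hy
  have hu : (-1 : (ZMod ℓ)ˣ) = Units.mk0 y hy0 * Units.mk0 y hy0 := by
    ext
    rw [Units.val_neg, Units.val_one, Units.val_mul, Units.val_mk0, hy]
  rw [hu, map_mul, toAdd_mul, map_add, add_self_zmod_two]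

/-- `unitsMap` commutes with negation (it is induced by a ring homomorphism). -/
theorem unitsMap_neg' {ℓ n : ℕ} (h : ℓ ∣ n) (a : (ZMod n)ˣ) : ZMod.unitsMap h (-a) = -ZMod.unitsMap h a := by
  ext
  change (ZMod.castHom h (ZMod ℓ)) (((-a : (ZMod n)ˣ) : ZMod n)) = -((ZMod.castHom h (ZMod ℓ)) ((a : (ZMod n)ˣ) : ZMod n))
  rw [Units.val_neg, map_neg]

/-- **PAIRING LAW.** For `n > 1` odd with every prime factor `≡ 1 (mod 4)`, every scaling `c`, every level `k ≥ 1` and all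
discrete logarithms `ψ`, the scaled Kurihara number at `2` reduces to `0` mod `2`. (Terms at `a` and `−a` agree: `[−r]⁺ = [r]⁺`,
`ψ_ℓ(−a) = ψ_ℓ(−1)ψ_ℓ(a)` with `ψ_ℓ(−1)` even; `a ≠ −a`.) -/
theorem toMod2_kuriharaNumberScaled_eq_zero {N : ℕ} [NeZero N] (f : CuspForm (Gamma0 N) 2) (c : ℚ) {k n : ℕ} [NeZero n]
    (hk : 1 ≤ k) (hn : 1 < n) (hodd : Odd n) (h4 : ∀ ℓ ∈ n.primeFactors, ℓ % 4 = 1)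
    (ψ : (ℓ : ℕ) → (ZMod ℓ)ˣ →* Multiplicative (ZMod (2 ^ k))) :
    toMod2 k hk (kuriharaNumberScaled f c k n ψ) = 0 := by
  unfold kuriharaNumberScaled
  rw [map_sum]
  refine Finset.sum_ninvolution (fun a => -a) ?_ ?_ (fun a => Finset.mem_univ _) (fun a => neg_neg a)
  · intro a
    have hsym := ratPlusSymbol_val_neg_div f hn a
    have hchar : ∀ (ℓ : ℕ) (hℓ : ℓ ∈ n.primeFactors),
        toMod2 k hk (Multiplicative.toAdd (ψ ℓ (ZMod.unitsMap (Nat.dvd_of_mem_primeFactors hℓ) (-a)))) =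
        toMod2 k hk (Multiplicative.toAdd (ψ ℓ (ZMod.unitsMap (Nat.dvd_of_mem_primeFactors hℓ) a))) := by
      intro ℓ hℓ
      rw [unitsMap_neg' _ a, neg_eq_neg_one_mul, map_mul, toAdd_mul, map_add,
        toMod2_toAdd_neg_one_eq_zero hk (Nat.prime_of_mem_primeFactors hℓ) (h4 ℓ hℓ) (ψ ℓ), zero_add]
    rw [map_mul, map_mul, map_prod, map_prod, hsym,
      Finset.prod_congr rfl (fun ℓ _ => (hchar ℓ.1 ℓ.2).symm)]
    exact add_self_zmod_two _
  · intro a _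
    exact units_neg_ne_self hn hodd a

/-- Corollary: under the hypotheses of the pairing law NO scaled Kurihara number is a unit of `ℤ/2^k`. -/
theorem not_isUnit_kuriharaNumberScaled {N : ℕ} [NeZero N] (f : CuspForm (Gamma0 N) 2) (c : ℚ) {k n : ℕ} [NeZero n]
    (hk : 1 ≤ k) (hn : 1 < n) (hodd : Odd n) (h4 : ∀ ℓ ∈ n.primeFactors, ℓ % 4 = 1)
    (ψ : (ℓ : ℕ) → (ZMod ℓ)ˣ →* Multiplicative (ZMod (2 ^ k))) :
    ¬ IsUnit (kuriharaNumberScaled f c k n ψ) := by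
  intro hu
  have h := hu.map (toMod2 k hk)
  rw [toMod2_kuriharaNumberScaled_eq_zero f c hk hn hodd h4 ψ] at h
  exact not_isUnit_zero h

/-- Kolyvagin products at `2` of level `k ≥ 2` have all prime factors `≡ 1 (mod 4)` and are odd. -/
theorem mod_four_of_isKolyvaginProduct (W : WeierstrassCurve ℚ) [W.IsGloballyMinimal] {k n : ℕ} (hk : 2 ≤ k)
    (hn : Kato.IsKolyvaginProduct W 2 k n) : (∀ ℓ ∈ n.primeFactors, ℓ % 4 = 1) ∧ Odd n := by
  have h4 : ∀ ℓ ∈ n.primeFactors, ℓ % 4 = 1 := by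
    intro ℓ hℓ
    have hK := hn.2 ℓ hℓ
    have hmod : ℓ ≡ 1 [MOD 2 ^ k] := hK.2.2.1
    have h4dvd : 4 ∣ 2 ^ k := by
      obtain ⟨j, rfl⟩ := Nat.exists_eq_add_of_le hk
      exact ⟨2 ^ j, by ring⟩
    have hmod4 : ℓ ≡ 1 [MOD 4] := hmod.of_dvd h4dvd
    have hℓ2 : 2 ≤ ℓ := (Nat.prime_of_mem_primeFactors hℓ).two_le
    unfold Nat.ModEq at hmod4
    omega
  refine ⟨h4, ?_⟩
  have hn0 : n ≠ 0 := Squarefree.ne_zero hn.1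
  rw [Nat.odd_iff]
  by_contra hne
  have h2dvd : 2 ∣ n := Nat.dvd_of_mod_eq_zero (by omega)
  have hmem : 2 ∈ n.primeFactors := Nat.mem_primeFactors.2 ⟨Nat.prime_two, h2dvd, hn0⟩
  have := h4 2 hmem
  omega

/-- **No unit Kurihara witness at `2` lives at level `k ≥ 2`** (except at the trivial level `n = 1`). -/
theorem not_isUnit_kuriharaNumberScaled_of_two_le (W : WeierstrassCurve ℚ) [W.IsGloballyMinimal]
    {N : ℕ} [NeZero N] (f : CuspForm (Gamma0 N) 2) (c : ℚ) {k n : ℕ} [NeZero n] (hk : 2 ≤ k) (hn1 : n ≠ 1)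
    (hn : Kato.IsKolyvaginProduct W 2 k n) (ψ : (ℓ : ℕ) → (ZMod ℓ)ˣ →* Multiplicative (ZMod (2 ^ k))) :
    ¬ IsUnit (kuriharaNumberScaled f c k n ψ) := by
  obtain ⟨h4, hodd⟩ := mod_four_of_isKolyvaginProduct W hk hn
  have hn0 : n ≠ 0 := Squarefree.ne_zero hn.1
  exact not_isUnit_kuriharaNumberScaled f c (by omega) (by omega) hodd h4 ψ

/-- **Every unit Kurihara witness at `2` is LEVEL-ONE and QUADRATIC**: its level is `n = 1` (the `L`-value `c·[0]⁺` itself is odd —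
rank zero only), or `k = 1` and `n` contains a prime `≡ 3 (mod 4)`. -/
theorem unitKuriharaWitnessAtTwo_shape (W : WeierstrassCurve ℚ) [W.IsElliptic] [W.IsGloballyMinimal]
    {N : ℕ} [NeZero N] (f : CuspForm (Gamma0 N) 2) (c : ℚ) (k n : ℕ) [NeZero n]
    (ψ : (ℓ : ℕ) → (ZMod ℓ)ˣ →* Multiplicative (ZMod (2 ^ k)))
    (hk : 1 ≤ k) (hn : Kato.IsKolyvaginProduct W 2 k n) (hu : IsUnit (kuriharaNumberScaled f c k n ψ)) :
    n = 1 ∨ (k = 1 ∧ ∃ ℓ ∈ n.primeFactors, ℓ % 4 = 3) := by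
  by_cases hn1 : n = 1
  · exact Or.inl hn1
  right
  have hk1 : k = 1 := by
    by_contra hk2
    exact not_isUnit_kuriharaNumberScaled_of_two_le W f c (by omega) hn1 hn ψ hu
  refine ⟨hk1, ?_⟩
  by_contra hnone
  push Not at hnone
  have hn0 : n ≠ 0 := Squarefree.ne_zero hn.1
  -- every prime factor is odd (a Kolyvagin prime does not divide `N·2`) and not `≡ 3 (mod 4)`, hence `≡ 1 (mod 4)`
  have hoddℓ : ∀ ℓ ∈ n.primeFactors, ℓ % 2 = 1 := by
    intro ℓ hℓ
    have hK := hn.2 ℓ hℓ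
    have hℓp : ℓ.Prime := Nat.prime_of_mem_primeFactors hℓ
    rcases hℓp.eq_two_or_odd' with h2 | hodd
    · exfalso
      apply hK.2.1
      rw [h2]
      exact dvd_mul_left 2 _
    · exact Nat.odd_iff.1 hodd
  have h4 : ∀ ℓ ∈ n.primeFactors, ℓ % 4 = 1 := by
    intro ℓ hℓ
    have h3 := hnone ℓ hℓ
    have h1 := hoddℓ ℓ hℓ
    omega
  have hodd : Odd n := by
    rw [Nat.odd_iff]
    by_contra hne
    have h2dvd : 2 ∣ n := Nat.dvd_of_mod_eq_zero (by omega)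
    have hmem : 2 ∈ n.primeFactors := Nat.mem_primeFactors.2 ⟨Nat.prime_two, h2dvd, hn0⟩
    have := hoddℓ 2 hmem
    omega
  exact not_isUnit_kuriharaNumberScaled f c hk (by omega) hodd h4 ψ hu

/-! ## §2. The Zhai cell and the twisted unit sums (typed; the dictionary as named statements) -/

/-- The (scaled) **non-residue cell sum** `Z_n(f, c) = Σ_{a ∈ (ℤ/n)ˣ, (a/ℓ) = −1 ∀ ℓ ∣ n} c·[a/n]⁺_f ∈ ℚ` — the cell of the
Manin–Zhai partition of `(ℤ/n)ˣ` by Legendre sign vectors on which a level-one Kurihara number at `2` lives. -/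
def zhaiCell {N : ℕ} (f : CuspForm (Gamma0 N) 2) (c : ℚ) (n : ℕ) [NeZero n] : ℚ :=
  ∑ a ∈ (Finset.univ : Finset (ZMod n)ˣ).filter
      (fun a => ∀ ℓ ∈ n.primeFactors, jacobiSym (((a : ZMod n).val : ℕ) : ℤ) ℓ = -1),
    c * ratPlusSymbol f ((((a : ZMod n).val : ℕ) : ℚ) / n)

/-- The **twisted unit sum** `U_{d,n}(f) = Σ_{a ∈ (ℤ/n)ˣ} χ_d(a)·[a/n]⁺_f`, `χ_d = ∏_{q ∣ d} (·/q)` (for `d = n`: the primitive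
Birch sum `∝ L(f ⊗ χ_d, 1)`; for `d = 1`: `Σ_{(a,n)=1} [a/n]⁺ = ∏_{q ∣ n}(a_q − 2)·[0]⁺`). -/
def twistedUnitSum {N : ℕ} (f : CuspForm (Gamma0 N) 2) (n d : ℕ) [NeZero n] : ℚ :=
  ∑ a : (ZMod n)ˣ, (jacobiSym (((a : ZMod n).val : ℕ) : ℤ) d : ℚ) * ratPlusSymbol f ((((a : ZMod n).val : ℕ) : ℚ) / n)

/-- DICTIONARY (i), Möbius: `2^{ν(n)} · Z_n = c · Σ_{d ∣ n} (−1)^{ν(d)} U_{d,n}` (expand `∏_ℓ (1 − (a/ℓ))/2`). Pure algebra. -/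
def ZhaiCellMoebius : Prop :=
  ∀ {N : ℕ} (f : CuspForm (Gamma0 N) 2) (c : ℚ) (n : ℕ) [NeZero n], Odd n → Squarefree n →
    (2 : ℚ) ^ n.primeFactors.card * zhaiCell f c n =
      c * ∑ d ∈ n.divisors, (-1 : ℚ) ^ d.primeFactors.card * twistedUnitSum f n d

/-- DICTIONARY (ii), Hecke (Cai–Li–Zhai 2020 Lemma 4.1, extended to `d = 1`): for `d ∣ n`, `(n, N) = 1`,
`U_{d,n} = ∏_{q ∣ n/d} (a_q − 2χ_d(q)) · U_{d,d}`; and `U_{d,d} = 0` when `d ≡ 3 (mod 4)` (odd character against even symbols). -/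
def TwistedUnitSumHecke : Prop :=
  ∀ (W : WeierstrassCurve ℚ) [W.IsElliptic] [W.IsGloballyMinimal] [NeZero (W.conductorNorm ℤ)]
    (f : CuspForm (Gamma0 (W.conductorNorm ℤ)) 2), IsNewformOf W f →
    ∀ (n d : ℕ) [NeZero n] [NeZero d], Odd n → Squarefree n → n.Coprime (W.conductorNorm ℤ) → d ∣ n →
      twistedUnitSum f n d =
        (∏ q ∈ (n / d).primeFactors, ((W.frobeniusTrace q : ℚ) - 2 * jacobiSym (q : ℤ) d)) * twistedUnitSum f d d
      ∧ (d % 4 = 3 → twistedUnitSum f d d = 0)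

/-- DICTIONARY (iii), the mod-2 reading: for `n > 1` odd square-free with 2-integral scaled symbols, the level-one scaled
Kurihara number for LEGENDRE logarithms (`ψ_ℓ` onto `ℤ/2`) is the reduction of the cell: `δ^{(c)}_n = Z_n mod 2`; in particular
a 2-adic UNIT cell yields a unit Kurihara witness (with surjective `ψ`). Stated in the direction the supply needs. -/
def KuriharaUnitOfZhaiCellUnitAtTwo : Prop :=
  ∀ {N : ℕ} [NeZero N] (f : CuspForm (Gamma0 N) 2) (c : ℚ) (n : ℕ) [NeZero n], Odd n → Squarefree n → 1 < n →
    (∀ r : ℚ, ‖((c * ratPlusSymbol f r : ℚ) : ℚ_[2])‖ ≤ 1) →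
    ‖((zhaiCell f c n : ℚ) : ℚ_[2])‖ = 1 →
    ∃ ψ : (ℓ : ℕ) → (ZMod ℓ)ˣ →* Multiplicative (ZMod (2 ^ 1)),
      (∀ ℓ ∈ n.primeFactors, Function.Surjective (ψ ℓ)) ∧ IsUnit (kuriharaNumberScaled f c 1 n ψ)

/-! ## §3. The Ω-ADIC LINE (`Ω := 𝔽₂⟦T⟧`): mod-2, cyclotomic-depth Kolyvagin rigidity — typed statements and the composition

Reading of the crux on its habitat: with `Ω = Λ/2Λ = 𝔽₂⟦T⟧` (a DVR with uniformiser `T`) and `𝕋 := E[2] ⊗ Ω(Ψ̄)` (Ψ̄ the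
tautological character `Γ → Ωˣ`, `γ ↦ 1 + T`), `λ_alg(E) = length_Ω(X/2X)` and `λ_an(E) = ord_T(c·L₂(E,T) mod 2)` whenever
`μ = 0`; the Kolyvagin primes of `𝕋/T^j` are the TRANSPOSITION primes `q` (Frob_q a transposition on `E[2]`) with `⟨q⟩ ≡ 1
(mod 2^{ε+2})`, `2^{ε+1} ≥ j` — i.e. `q ≡ ±1 (mod 2^{ε+2})`: depth is bought in the REAL cyclotomic tower, so primes `q ≡ 3 (mod 4)`
(`q ≡ −1`) — where §1 puts every unit — are admissible at every depth, and no condition `q ≡ 1 (mod 2^k)` ever appears. -/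

/-- `q` has real-tower depth `≥ ε`: `⟨q⟩ ≡ 1 (mod 2^{ε+2})`, i.e. `q ≡ ±1 (mod 2^{ε+2})` (`q` splits completely in the `ε`-th layer
`ℚ_ε = ℚ(ζ_{2^{ε+2}})⁺` of the cyclotomic `ℤ₂`-extension). Depth `0` is vacuous for odd `q`. -/
def RealTowerDepth (q ε : ℕ) : Prop :=
  q % 2 ^ (ε + 2) = 1 ∨ q % 2 ^ (ε + 2) = 2 ^ (ε + 2) - 1

/-- A **deep level-one unit Kurihara witness** at `2` for `(W, f)` at depth `ε`: ideator 1's witness shape at level `k = 1`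
(Legendre logarithms), on a square-free product `n` of TRANSPOSITION primes (`a_q` even and `#Ẽ(𝔽_q)[2] ≤ 2`, the X4 shape
`KuriharaUnitAt` at `p = 2`) each of real-tower depth `≥ ε`. -/
def DeepLevelOneUnitWitnessAtTwo (W : WeierstrassCurve ℚ) [W.IsElliptic] [W.IsGloballyMinimal]
    {N : ℕ} (f : CuspForm (Gamma0 N) 2) (ε : ℕ) : Prop :=
  ∃ (c : ℚ) (n : ℕ) (_ : NeZero n) (ψ : (ℓ : ℕ) → (ZMod ℓ)ˣ →* Multiplicative (ZMod (2 ^ 1))),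
    c ≠ 0 ∧ (∀ r : ℚ, ‖((c * ratPlusSymbol f r : ℚ) : ℚ_[2])‖ ≤ 1) ∧
    Kato.IsKolyvaginProduct W 2 1 n ∧
    (∀ (q : ℕ) [Fact q.Prime], q ∣ n →
      Nat.card {P : ((WeierstrassCurve.integralModelInt W).map (Int.castRingHom (ZMod q))).toAffine.Point // 2 • P = 0} ≤ 2) ∧
    (∀ q ∈ n.primeFactors, RealTowerDepth q ε) ∧
    (∀ ℓ ∈ n.primeFactors, Function.Surjective (ψ ℓ)) ∧
    IsUnit (kuriharaNumberScaled f c 1 n ψ)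

/-- A deep level-one unit witness is in particular ideator 1's `UnitKuriharaWitnessAtTwo` (level `1`). -/
theorem unitKuriharaWitnessAtTwo_of_deep (W : WeierstrassCurve ℚ) [W.IsElliptic] [W.IsGloballyMinimal]
    {N : ℕ} (f : CuspForm (Gamma0 N) 2) (ε : ℕ) (h : DeepLevelOneUnitWitnessAtTwo W f ε) :
    UnitKuriharaWitnessAtTwo W f := by
  obtain ⟨c, n, hn, ψ, hc0, hint, hK, -, -, hψ, hu⟩ := h
  exact ⟨c, 1, n, hn, ψ, hc0, hint, le_rfl, hK, hψ, hu⟩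

/-- Arithmetic of depth vs §1: a prime `q ≡ 3 (mod 4)` of depth `≥ ε` is `≡ −1 (mod 2^{ε+2})`. -/
theorem realTowerDepth_of_three_mod_four {q ε : ℕ} (h3 : q % 4 = 3) (hd : RealTowerDepth q ε) :
    q % 2 ^ (ε + 2) = 2 ^ (ε + 2) - 1 := by
  rcases hd with h1 | h1
  · exfalso
    have h4 : 4 ∣ 2 ^ (ε + 2) := ⟨2 ^ ε, by ring⟩
    have := Nat.mod_mod_of_dvd q h4
    rw [h1] at this
    omega
  · exact h1

/-- **§1 read at depth** (proved): in a deep unit witness with `n ≠ 1`, some prime of `n` is `≡ −1 (mod 2^{ε+2})` — the units of the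
mod-2 Kolyvagin theory at `2` are carried by primes that are `−1`, never `+1`, deep in the real tower. -/
theorem deepWitness_has_minus_one_prime (W : WeierstrassCurve ℚ) [W.IsElliptic] [W.IsGloballyMinimal]
    {N : ℕ} [NeZero N] (f : CuspForm (Gamma0 N) 2) (ε : ℕ) (c : ℚ) (n : ℕ) [NeZero n]
    (ψ : (ℓ : ℕ) → (ZMod ℓ)ˣ →* Multiplicative (ZMod (2 ^ 1))) (hn1 : n ≠ 1)
    (hK : Kato.IsKolyvaginProduct W 2 1 n) (hd : ∀ q ∈ n.primeFactors, RealTowerDepth q ε)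
    (hu : IsUnit (kuriharaNumberScaled f c 1 n ψ)) :
    ∃ q ∈ n.primeFactors, q % 2 ^ (ε + 2) = 2 ^ (ε + 2) - 1 := by
  rcases unitKuriharaWitnessAtTwo_shape W f c 1 n ψ le_rfl hK hu with h | ⟨-, q, hq, hq3⟩
  · exact absurd h hn1
  · exact ⟨q, hq, realTowerDepth_of_three_mod_four hq3 (hd q hq)⟩

/-- The **habitat** `𝓗_Ω` of the Ω-adic line: `ρ̄_{E,2}` onto `GL₂(𝔽₂) ≅ S₃` ((H.1): `E[2]` absolutely irreducible);
`ℚ(√Δ) ∉ {ℚ(i), ℚ(√2), ℚ(√−2)}` ((H.2)_Ω: a transposition lies in `G_{ℚ(μ_{2^∞})}`, and `ℚ(E[2])`, `ℚ(μ_{2^∞})` are disjoint,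
whence `H¹(Gal(ℚ(E[2])ℚ(μ_{2^∞})/ℚ), E[2] ⊗ Ω_j(Ψ̄)) = 0` at every depth — no class `c₀`); `2 ∤ ∏ c_ℓ` (Kato's Λ-adic Kolyvagin
system is nonzero mod `2`; for `2 ∣ ∏ c_ℓ` every level-one Kurihara number is expected even, cf. X4 `not_kuriharaUnitAt_of_bsdp_of_dvd_tamagawaProduct`). -/
def OmegaHabitat (W : WeierstrassCurve ℚ) [W.IsElliptic] : Prop :=
  W.HasSurjectiveModNGaloisRep 2 ∧ ¬ IsSquare (-W.Δ) ∧ ¬ IsSquare (2 * W.Δ) ∧ ¬ IsSquare (-2 * W.Δ) ∧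
    Odd W.tamagawaProduct

/-- **(Ω-R) Ω-ADIC RIGIDITY AT 2** — the TRANSFER `C⁺` of the line (research-open; Mazur–Rubin §§4–5 over the artinian principal rings
`Ω_j = 𝔽₂[T]/(T^j)` for `(E[2] ⊗ Ω_j(Ψ̄), F̄_Λ, 𝒫_{(j)})` + the four-term sequence + the mod-2 Coleman dictionary with its exact
anomalous/Euler corrections): on `𝓗_Ω`, deep level-one unit witnesses at every depth force `λ_an ≤ λ_alg` (indeed `λ_an = λ_alg`
and `μ = 0`). Stated per newform exactly in the shape `LambdaHalfAtTwo` consumes. Nothing asserted. -/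
def OmegaAdicRigidityAtTwo : Prop :=
  ∀ (W : WeierstrassCurve ℚ) [W.IsElliptic] [W.IsGloballyMinimal], ¬ W.HasCM → GoodOrd W 2 → OmegaHabitat W →
    (∀ [NeZero (W.conductorNorm ℤ)] (f : CuspForm (Gamma0 (W.conductorNorm ℤ)) 2), IsNewformOf W f →
      ∀ ε : ℕ, DeepLevelOneUnitWitnessAtTwo W f ε) →
    LambdaHalfAtTwo W

/-- **(Ω-S) DEEP LEVEL-ONE SUPPLY AT 2** (research-open in `∀` form, decidable per curve and depth; = Kurihara's conjecture mod `2`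
at level one on `𝓗_Ω`, restricted to transposition primes `q ≡ ±1 (mod 2^{ε+2})`; by §2 an exact-2-adic-valuation statement about
`L(E^{(d)}, 1)`, `d ∣ n`, `d ≡ 1 (mod 4)`). -/
def DeepLevelOneSupplyAtTwo : Prop :=
  ∀ (W : WeierstrassCurve ℚ) [W.IsElliptic] [W.IsGloballyMinimal], ¬ W.HasCM → GoodOrd W 2 → OmegaHabitat W →
    ∀ [NeZero (W.conductorNorm ℤ)] (f : CuspForm (Gamma0 (W.conductorNorm ℤ)) 2), IsNewformOf W f →
      ∀ ε : ℕ, DeepLevelOneUnitWitnessAtTwo W f ε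

/-- **(Ω-S′) the same supply through the Zhai cell** (§2): a depth-`ε` transposition product `n > 1` with a 2-adic UNIT cell `Z_n`. -/
def DeepZhaiCellSupplyAtTwo : Prop :=
  ∀ (W : WeierstrassCurve ℚ) [W.IsElliptic] [W.IsGloballyMinimal], ¬ W.HasCM → GoodOrd W 2 → OmegaHabitat W →
    ∀ [NeZero (W.conductorNorm ℤ)] (f : CuspForm (Gamma0 (W.conductorNorm ℤ)) 2), IsNewformOf W f →
      ∀ ε : ℕ, ∃ (c : ℚ) (n : ℕ) (_ : NeZero n), c ≠ 0 ∧ (∀ r : ℚ, ‖((c * ratPlusSymbol f r : ℚ) : ℚ_[2])‖ ≤ 1) ∧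
        1 < n ∧ Odd n ∧ Kato.IsKolyvaginProduct W 2 1 n ∧
        (∀ (q : ℕ) [Fact q.Prime], q ∣ n →
          Nat.card {P : ((WeierstrassCurve.integralModelInt W).map (Int.castRingHom (ZMod q))).toAffine.Point // 2 • P = 0} ≤ 2) ∧
        (∀ q ∈ n.primeFactors, RealTowerDepth q ε) ∧
        ‖((zhaiCell f c n : ℚ) : ℚ_[2])‖ = 1

/-- Cells feed witnesses (kernel-checked): mod-2 dictionary (iii) ∧ deep cell supply ⟹ deep witness supply. -/
theorem deepLevelOneSupply_of_zhaiCell (hD : KuriharaUnitOfZhaiCellUnitAtTwo) (hZ : DeepZhaiCellSupplyAtTwo) :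
    DeepLevelOneSupplyAtTwo := by
  intro W _ _ hcm hgo hH _ f hf ε
  obtain ⟨c, n, hn, hc0, hint, hn1, hodd, hK, htr, hd, hunit⟩ := hZ W hcm hgo hH f hf ε
  obtain ⟨ψ, hψ, hu⟩ := hD f c n hodd hK.1 hn1 hint hunit
  exact ⟨c, n, hn, ψ, hc0, hint, hK, htr, hd, hψ, hu⟩

/-- **OFF-HABITAT RESIDUAL** — NOT part of this line: the crux restricted to the complement of `𝓗_Ω` (reducible / `C₃`-image `E[2]`,
`ℚ(√Δ) ∈ {ℚ(i), ℚ(√±2)}`, or `2 ∣ ∏ c_ℓ`), owned by the (β)-habitat cards and by Tamagawa-defect division; typed only so that the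
composition below concludes the crux BY NAME for every `W`. -/
def OffHabitatLambdaHalfAtTwo : Prop :=
  ∀ (W : WeierstrassCurve ℚ) [W.IsElliptic] [W.IsGloballyMinimal], ¬ W.HasCM → GoodOrd W 2 → ¬ OmegaHabitat W →
    LambdaHalfAtTwo W

/-- **Composition to the crux BY NAME** (kernel-checked, no `sorry`): Ω-adic rigidity ∧ deep level-one supply (on `𝓗_Ω`) ∧ the
off-habitat residual ⟹ `OrdLambdaHalfAtTwo`. -/
theorem ordLambdaHalfAtTwo_of_omegaAdic (hR : OmegaAdicRigidityAtTwo) (hS : DeepLevelOneSupplyAtTwo)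
    (hOff : OffHabitatLambdaHalfAtTwo) :
    Summit.BirchSwinnertonDyer.BirchSwinnertonDyer.Theses.TwoAdicConverse.OrdLambdaHalfAtTwo := by
  show Summit.BirchSwinnertonDyer.BirchSwinnertonDyer.Theorems.TwoAdicTwistConverse.OrdLambdaHalfAtTwo
  intro W _ _ hcm hgo
  by_cases hH : OmegaHabitat W
  · exact hR W hcm hgo hH (fun f hf ε => hS W hcm hgo hH f hf ε)
  · exact hOff W hcm hgo hH

/-- The same through cells. -/
theorem ordLambdaHalfAtTwo_of_omegaAdic_zhaiCell (hR : OmegaAdicRigidityAtTwo) (hD : KuriharaUnitOfZhaiCellUnitAtTwo)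
    (hZ : DeepZhaiCellSupplyAtTwo) (hOff : OffHabitatLambdaHalfAtTwo) :
    Summit.BirchSwinnertonDyer.BirchSwinnertonDyer.Theses.TwoAdicConverse.OrdLambdaHalfAtTwo :=
  ordLambdaHalfAtTwo_of_omegaAdic hR (deepLevelOneSupply_of_zhaiCell hD hZ) hOff

end Summit.BirchSwinnertonDyer.BirchSwinnertonDyer.Cruxes.OrdLambdaHalfAtTwo.OmegaAdicKolyvaginTwo

end
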